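import Mathlib.Analysis.Fourier.AddCircleMulti
import Mathlib.MeasureTheory.Integral.Prod
import Mathlib.MeasureTheory.Constructions.Pi
import Literature.Analysis.Complex.PeriodicStripFourier
import HarnessLib

/-!
# Fourier coefficients on the `2`-torus of a function analytic in a strip in ONE coordinate decay exponentially in that index

Companion of `Literature/Analysis/Complex/PeriodicStripFourier` (the `1`-periodic rescaling of its `2π`-periodic strip bound, and the
coordinatewise application on `UnitAddTorus (Fin 2)` by Fubini on the unit square).  Everything is PROVED; no definitions, no named facts.

* `norm_intervalIntegral_mul_cexp_le_of_periodic_strip_one` — `1`-periodic `v`, holomorphic and bounded by `M` on `|Im z| < a`: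
  `‖∫₀¹ v(s) e^{-2πijs} ds‖ ≤ M e^{-2πa|j|}` [cite: TrefethenWeideman2014, §4 eqs. (4.5), (4.11)] (rescaled);
* `norm_mFourierCoeff_le_exp_of_strip_snd` / `norm_mFourierCoeff_le_exp_of_strip_fst` — for `f : UnitAddTorus (Fin 2) → ℂ` measurable whose
  sections in the second (resp. first) coordinate are restrictions to `ℝ` of `1`-periodic functions holomorphic and bounded by `M` on the strip
  `|Im| < a`: `‖𝓕f(n)‖ ≤ M e^{-2πa|n₁|}` (resp. `e^{-2πa|n₀|}`) — the coordinatewise ANALYTICITY-STRIP estimate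
  [cite: TrefethenWeideman2014, §4 Thm. 4.2 proof p. 398]; [cite: Grafakos2014, §3.1.1 (Fubini on the torus)].
-/

noncomputable section

open Complex MeasureTheory Set Filter intervalIntegral Real
open scoped Topology

namespace Literature.Analysis.Complex

/-- **`1`-periodic strip bound.** If `v` is holomorphic on `|Im z| < a` (`a > 0`), `1`-periodic and bounded there by `M`, then for every integer `j`
`‖∫₀¹ v(s)·e^{-2πijs} ds‖ ≤ M·e^{-2πa|j|}` (rescale `z ↦ z/(2π)` in `norm_integral_mul_exp_le_of_periodic_strip`).
[cite: TrefethenWeideman2014, §4 eqs. (4.5), (4.11)] -/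
theorem norm_intervalIntegral_mul_cexp_le_of_periodic_strip_one {v : ℂ → ℂ} {a M : ℝ} (ha : 0 < a)
    (hd : DifferentiableOn ℂ v {z : ℂ | |z.im| < a}) (hper : ∀ z : ℂ, v (z + 1) = v z)
    (hM : ∀ z : ℂ, |z.im| < a → ‖v z‖ ≤ M) (j : ℤ) :
    ‖∫ s in (0 : ℝ)..1, v s * Complex.exp (-(2 * π * I * j * s))‖ ≤ M * Real.exp (-(2 * π * a * |(j : ℝ)|)) := by
  have h2π : (0 : ℝ) < 2 * π := Real.two_pi_pos
  have h2πC : (2 * π : ℂ) ≠ 0 := by exact_mod_cast h2π.ne'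
  -- the rescaled `2π`-periodic function
  set u : ℂ → ℂ := fun z => v (z / (2 * π)) with hu
  have hdu : DifferentiableOn ℂ u {z : ℂ | |z.im| < 2 * π * a} := by
    refine hd.comp ((differentiable_id.div_const _).differentiableOn) fun z hz => ?_
    simp only [Set.mem_setOf_eq] at hz ⊢
    have : (z / (2 * π)).im = z.im / (2 * π) := by
      rw [show (2 * π : ℂ) = ((2 * π : ℝ) : ℂ) by push_cast; rfl, Complex.div_ofReal_im]
    rw [this, abs_div, abs_of_pos h2π, div_lt_iff₀ h2π]
    linarith [mul_comm a (2 * π)]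
  have hperu : ∀ z : ℂ, u (z + 2 * π) = u z := fun z => by
    simp only [hu]
    rw [add_div, div_self h2πC, hper]
  have hMu : ∀ z : ℂ, |z.im| < 2 * π * a → ‖u z‖ ≤ M := fun z hz => by
    refine hM _ ?_
    have : (z / (2 * π)).im = z.im / (2 * π) := by
      rw [show (2 * π : ℂ) = ((2 * π : ℝ) : ℂ) by push_cast; rfl, Complex.div_ofReal_im]
    rw [this, abs_div, abs_of_pos h2π, div_lt_iff₀ h2π]
    linarith [mul_comm a (2 * π)]
  have key := norm_integral_mul_exp_le_of_periodic_strip (by positivity : 0 < 2 * π * a) hdu hperu hMu j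
  -- change of variables `x = 2π s`
  have hcv : (2 * π : ℝ) • ∫ s in (0 : ℝ)..1, v s * Complex.exp (-(2 * π * I * j * s)) =
      ∫ x in (0 : ℝ)..2 * π, u x * Complex.exp (-(I * j * x)) := by
    have h := intervalIntegral.smul_integral_comp_mul_left (fun x : ℝ => u x * Complex.exp (-(I * j * x))) (2 * π) (a := 0) (b := 1)
    rw [mul_zero, mul_one] at h
    rw [← h]
    congr 1
    refine intervalIntegral.integral_congr fun s _ => ?_
    simp only [hu]
    have hs : (((2 * π * s : ℝ) : ℂ)) / (2 * π) = s := by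
      push_cast
      field_simp
    rw [hs]
    congr 1
    push_cast
    ring_nf
  have hnorm : ‖(2 * π : ℝ) • ∫ s in (0 : ℝ)..1, v s * Complex.exp (-(2 * π * I * j * s))‖ =
      2 * π * ‖∫ s in (0 : ℝ)..1, v s * Complex.exp (-(2 * π * I * j * s))‖ := by
    rw [norm_smul, Real.norm_of_nonneg h2π.le]
  have := key
  rw [← hcv, hnorm] at this
  have h3 : 2 * π * ‖∫ s in (0 : ℝ)..1, v s * Complex.exp (-(2 * π * I * j * s))‖ ≤ 2 * π * (M * Real.exp (-(2 * π * a * |(j : ℝ)|))) := by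
    calc _ ≤ 2 * π * M * Real.exp (-(2 * π * a * |(j : ℝ)|)) := this
      _ = _ := by ring
  exact le_of_mul_le_mul_left h3 h2π

/-! ## The `2`-torus: coordinatewise strip bounds by Fubini on the unit square -/

/-- The coefficient integrand on the square, pulled back along `finTwoArrow⁻¹ (a, b) = ![a, b]`: the character factorises.
[cite: Grafakos2014, §3.1.1] -/
theorem mFourier_neg_vecCons_smul (f : UnitAddTorus (Fin 2) → ℂ) (n : Fin 2 → ℤ) (a b : ℝ) :
    (UnitAddTorus.mFourier (-n)) (fun i => (((![a, b] : Fin 2 → ℝ) i : ℝ) : UnitAddCircle)) •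
        f (fun i => (((![a, b] : Fin 2 → ℝ) i : ℝ) : UnitAddCircle)) =
      fourier (-n 0) (a : UnitAddCircle) * (fourier (-n 1) (b : UnitAddCircle) *
        f (fun i => (((![a, b] : Fin 2 → ℝ) i : ℝ) : UnitAddCircle))) := by
  rw [smul_eq_mul, ← mul_assoc]
  congr 1
  show (∏ i : Fin 2, fourier ((-n) i) ((((![a, b] : Fin 2 → ℝ) i : ℝ) : UnitAddCircle))) = _
  rw [Fin.prod_univ_two]
  simp only [Pi.neg_apply, Matrix.cons_val_zero, Matrix.cons_val_one]

/-- **Fourier coefficients on `𝕋²` as an integral over the unit square `(0,1]²` in `ℝ × ℝ`.** [cite: Grafakos2014, §3.1.1] -/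
theorem mFourierCoeff_eq_setIntegral_prod (f : UnitAddTorus (Fin 2) → ℂ) (n : Fin 2 → ℤ) :
    UnitAddTorus.mFourierCoeff f n =
      ∫ p in Ioc (0 : ℝ) 1 ×ˢ Ioc (0 : ℝ) 1,
        fourier (-n 0) (p.1 : UnitAddCircle) * (fourier (-n 1) (p.2 : UnitAddCircle) *
          f (fun i => (((![p.1, p.2] : Fin 2 → ℝ) i : ℝ) : UnitAddCircle))) := by
  rw [UnitAddTorus.mFourierCoeff_eq_integral f n (fun _ => (0 : ℝ))]
  simp only [zero_add]
  set F : (Fin 2 → ℝ) → ℂ := fun x => (UnitAddTorus.mFourier (-n)) (fun i => ((x i : ℝ) : UnitAddCircle)) •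
    f (fun i => ((x i : ℝ) : UnitAddCircle)) with hF
  have hpre : (MeasurableEquiv.finTwoArrow : (Fin 2 → ℝ) ≃ᵐ ℝ × ℝ) ⁻¹' (Ioc (0 : ℝ) 1 ×ˢ Ioc (0 : ℝ) 1) =
      {x : Fin 2 → ℝ | ∀ i, x i ∈ Ioc (0 : ℝ) 1} := by
    ext x
    simp only [Set.mem_preimage, MeasurableEquiv.finTwoArrow_apply, Set.mem_prod, Set.mem_setOf_eq, Fin.forall_fin_two]
  have h := (MeasureTheory.volume_preserving_finTwoArrow ℝ).setIntegral_preimage_emb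
    (MeasurableEquiv.finTwoArrow : (Fin 2 → ℝ) ≃ᵐ ℝ × ℝ).measurableEmbedding
    (fun p : ℝ × ℝ => F ((MeasurableEquiv.finTwoArrow : (Fin 2 → ℝ) ≃ᵐ ℝ × ℝ).symm p)) (Ioc (0 : ℝ) 1 ×ˢ Ioc (0 : ℝ) 1)
  simp only [MeasurableEquiv.symm_apply_apply] at h
  rw [hpre] at h
  rw [show (∫ x in {x : Fin 2 → ℝ | ∀ i, x i ∈ Ioc (0 : ℝ) 1}, (UnitAddTorus.mFourier (-n)) (fun i => ((x i : ℝ) : UnitAddCircle)) •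
      f (fun i => ((x i : ℝ) : UnitAddCircle))) = ∫ x in {x : Fin 2 → ℝ | ∀ i, x i ∈ Ioc (0 : ℝ) 1}, F x from rfl, h]
  refine setIntegral_congr_fun (measurableSet_Ioc.prod measurableSet_Ioc) fun p _ => ?_
  simp only [hF, MeasurableEquiv.finTwoArrow_symm_apply]
  exact mFourier_neg_vecCons_smul f n p.1 p.2

/-- **Coordinatewise analyticity-strip estimate on `𝕋²`, second coordinate.** Let `f : 𝕋² → ℂ` be measurable and suppose that for every
`s : ℝ` the section `t ↦ f(s, t)` is the restriction to `ℝ` of a `1`-periodic function `v s` holomorphic on the strip `|Im| < a` (`a > 0`) and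
bounded there by `M`.  Then `‖𝓕f(n)‖ ≤ M·e^{-2πa|n₁|}` for every `n ∈ ℤ²`.
[cite: TrefethenWeideman2014, §4 Thm. 4.2 (proof, p. 398)] -/
theorem norm_mFourierCoeff_le_exp_of_strip_snd {f : UnitAddTorus (Fin 2) → ℂ} (hf : Measurable f) {a M : ℝ} (ha : 0 < a)
    (v : ℝ → ℂ → ℂ) (hd : ∀ s, DifferentiableOn ℂ (v s) {z : ℂ | |z.im| < a}) (hper : ∀ s (z : ℂ), v s (z + 1) = v s z)
    (hM : ∀ s (z : ℂ), |z.im| < a → ‖v s z‖ ≤ M)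
    (hv : ∀ s t : ℝ, v s t = f (fun i => (((![s, t] : Fin 2 → ℝ) i : ℝ) : UnitAddCircle))) (n : Fin 2 → ℤ) :
    ‖UnitAddTorus.mFourierCoeff f n‖ ≤ M * Real.exp (-(2 * π * a * |(n 1 : ℝ)|)) := by
  have hM0 : 0 ≤ M := (norm_nonneg _).trans (hM 0 0 (by simpa using ha))
  -- the integrand on the square and its integrability
  set G : ℝ × ℝ → ℂ := fun p => fourier (-n 0) (p.1 : UnitAddCircle) * (fourier (-n 1) (p.2 : UnitAddCircle) *
    f (fun i => (((![p.1, p.2] : Fin 2 → ℝ) i : ℝ) : UnitAddCircle))) with hG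
  have hpt : Measurable fun p : ℝ × ℝ => (fun i => (((![p.1, p.2] : Fin 2 → ℝ) i : ℝ) : UnitAddCircle) : UnitAddTorus (Fin 2)) := by
    refine measurable_pi_lambda _ fun i => ?_
    refine (AddCircle.continuous_mk' (1 : ℝ)).measurable.comp ?_
    fin_cases i
    · exact measurable_fst
    · exact measurable_snd
  have hGm : Measurable G := by
    refine Measurable.mul ?_ (Measurable.mul ?_ (hf.comp hpt))
    · exact (ContinuousMap.continuous _).measurable.comp ((AddCircle.continuous_mk' (1 : ℝ)).measurable.comp measurable_fst)
    · exact (ContinuousMap.continuous _).measurable.comp ((AddCircle.continuous_mk' (1 : ℝ)).measurable.comp measurable_snd)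
  have hGb : ∀ p : ℝ × ℝ, ‖G p‖ ≤ M := fun p => by
    simp only [hG, norm_mul]
    rw [← hv p.1 p.2]
    have h1 : ‖fourier (-n 0) (p.1 : UnitAddCircle)‖ = 1 := Circle.norm_coe _
    have h2 : ‖fourier (-n 1) (p.2 : UnitAddCircle)‖ = 1 := Circle.norm_coe _
    rw [h1, h2, one_mul, one_mul]
    exact hM p.1 p.2 (by simpa using ha)
  have hvol : (volume : Measure (ℝ × ℝ)) (Ioc (0 : ℝ) 1 ×ˢ Ioc (0 : ℝ) 1) < ⊤ := by
    rw [Measure.volume_eq_prod, Measure.prod_prod]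
    simp
  have hGi : IntegrableOn G (Ioc (0 : ℝ) 1 ×ˢ Ioc (0 : ℝ) 1) volume :=
    Measure.integrableOn_of_bounded hvol.ne hGm.aestronglyMeasurable (Eventually.of_forall hGb)
  rw [mFourierCoeff_eq_setIntegral_prod f n]
  rw [show (∫ p in Ioc (0 : ℝ) 1 ×ˢ Ioc (0 : ℝ) 1, fourier (-n 0) (p.1 : UnitAddCircle) * (fourier (-n 1) (p.2 : UnitAddCircle) *
      f (fun i => (((![p.1, p.2] : Fin 2 → ℝ) i : ℝ) : UnitAddCircle)))) = ∫ p in Ioc (0 : ℝ) 1 ×ˢ Ioc (0 : ℝ) 1, G p from rfl]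
  rw [Measure.volume_eq_prod, setIntegral_prod G (by rwa [← Measure.volume_eq_prod])]
  -- the inner integral, section by section
  have hinner : ∀ s : ℝ, ‖∫ t in Ioc (0 : ℝ) 1, G (s, t)‖ ≤ M * Real.exp (-(2 * π * a * |(n 1 : ℝ)|)) := fun s => by
    simp only [hG]
    have h1 : ‖fourier (-n 0) (s : UnitAddCircle)‖ = 1 := Circle.norm_coe _
    rw [MeasureTheory.integral_const_mul, norm_mul, h1, one_mul, ← intervalIntegral.integral_of_le zero_le_one]
    have hcongr : (∫ t in (0 : ℝ)..1, fourier (-n 1) (t : UnitAddCircle) * f (fun i => (((![s, t] : Fin 2 → ℝ) i : ℝ) : UnitAddCircle))) =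
        ∫ t in (0 : ℝ)..1, v s t * Complex.exp (-(2 * π * I * (n 1) * t)) := by
      refine intervalIntegral.integral_congr fun t _ => ?_
      rw [← hv s t, fourier_coe_apply, mul_comm]
      congr 1
      push_cast
      ring_nf
    rw [hcongr]
    exact norm_intervalIntegral_mul_cexp_le_of_periodic_strip_one ha (hd s) (hper s) (hM s) (n 1)
  have hIoc : (volume : Measure ℝ) (Ioc (0 : ℝ) 1) < ⊤ := by simp
  calc ‖∫ s in Ioc (0 : ℝ) 1, ∫ t in Ioc (0 : ℝ) 1, G (s, t)‖
      ≤ (M * Real.exp (-(2 * π * a * |(n 1 : ℝ)|))) * ((volume : Measure ℝ) (Ioc (0 : ℝ) 1)).toReal :=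
        norm_setIntegral_le_of_norm_le_const hIoc fun s _ => hinner s
    _ = M * Real.exp (-(2 * π * a * |(n 1 : ℝ)|)) := by simp

/-- **Coordinatewise analyticity-strip estimate on `𝕋²`, first coordinate.** Let `f : 𝕋² → ℂ` be measurable and suppose that for every
`t : ℝ` the section `s ↦ f(s, t)` is the restriction to `ℝ` of a `1`-periodic function `v t` holomorphic on the strip `|Im| < a` (`a > 0`) and
bounded there by `M`.  Then `‖𝓕f(n)‖ ≤ M·e^{-2πa|n₀|}` for every `n ∈ ℤ²`.
[cite: TrefethenWeideman2014, §4 Thm. 4.2 (proof, p. 398)] -/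
theorem norm_mFourierCoeff_le_exp_of_strip_fst {f : UnitAddTorus (Fin 2) → ℂ} (hf : Measurable f) {a M : ℝ} (ha : 0 < a)
    (v : ℝ → ℂ → ℂ) (hd : ∀ t, DifferentiableOn ℂ (v t) {z : ℂ | |z.im| < a}) (hper : ∀ t (z : ℂ), v t (z + 1) = v t z)
    (hM : ∀ t (z : ℂ), |z.im| < a → ‖v t z‖ ≤ M)
    (hv : ∀ t s : ℝ, v t s = f (fun i => (((![s, t] : Fin 2 → ℝ) i : ℝ) : UnitAddCircle))) (n : Fin 2 → ℤ) :
    ‖UnitAddTorus.mFourierCoeff f n‖ ≤ M * Real.exp (-(2 * π * a * |(n 0 : ℝ)|)) := by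
  have hM0 : 0 ≤ M := (norm_nonneg _).trans (hM 0 0 (by simpa using ha))
  set G : ℝ × ℝ → ℂ := fun p => fourier (-n 0) (p.1 : UnitAddCircle) * (fourier (-n 1) (p.2 : UnitAddCircle) *
    f (fun i => (((![p.1, p.2] : Fin 2 → ℝ) i : ℝ) : UnitAddCircle))) with hG
  have hpt : Measurable fun p : ℝ × ℝ => (fun i => (((![p.1, p.2] : Fin 2 → ℝ) i : ℝ) : UnitAddCircle) : UnitAddTorus (Fin 2)) := by
    refine measurable_pi_lambda _ fun i => ?_
    refine (AddCircle.continuous_mk' (1 : ℝ)).measurable.comp ?_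
    fin_cases i
    · exact measurable_fst
    · exact measurable_snd
  have hGm : Measurable G := by
    refine Measurable.mul ?_ (Measurable.mul ?_ (hf.comp hpt))
    · exact (ContinuousMap.continuous _).measurable.comp ((AddCircle.continuous_mk' (1 : ℝ)).measurable.comp measurable_fst)
    · exact (ContinuousMap.continuous _).measurable.comp ((AddCircle.continuous_mk' (1 : ℝ)).measurable.comp measurable_snd)
  have hGb : ∀ p : ℝ × ℝ, ‖G p‖ ≤ M := fun p => by
    simp only [hG, norm_mul]
    rw [← hv p.2 p.1]
    have h1 : ‖fourier (-n 0) (p.1 : UnitAddCircle)‖ = 1 := Circle.norm_coe _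
    have h2 : ‖fourier (-n 1) (p.2 : UnitAddCircle)‖ = 1 := Circle.norm_coe _
    rw [h1, h2, one_mul, one_mul]
    exact hM p.2 p.1 (by simpa using ha)
  have hvol : (volume : Measure (ℝ × ℝ)) (Ioc (0 : ℝ) 1 ×ˢ Ioc (0 : ℝ) 1) < ⊤ := by
    rw [Measure.volume_eq_prod, Measure.prod_prod]
    simp
  have hGi : IntegrableOn G (Ioc (0 : ℝ) 1 ×ˢ Ioc (0 : ℝ) 1) volume :=
    Measure.integrableOn_of_bounded hvol.ne hGm.aestronglyMeasurable (Eventually.of_forall hGb)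
  have hGi' : Integrable G (((volume : Measure ℝ).restrict (Ioc (0 : ℝ) 1)).prod ((volume : Measure ℝ).restrict (Ioc (0 : ℝ) 1))) := by
    rw [Measure.prod_restrict, ← Measure.volume_eq_prod]
    exact hGi
  rw [mFourierCoeff_eq_setIntegral_prod f n]
  rw [show (∫ p in Ioc (0 : ℝ) 1 ×ˢ Ioc (0 : ℝ) 1, fourier (-n 0) (p.1 : UnitAddCircle) * (fourier (-n 1) (p.2 : UnitAddCircle) *
      f (fun i => (((![p.1, p.2] : Fin 2 → ℝ) i : ℝ) : UnitAddCircle)))) = ∫ p in Ioc (0 : ℝ) 1 ×ˢ Ioc (0 : ℝ) 1, G p from rfl]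
  rw [Measure.volume_eq_prod, ← Measure.prod_restrict, integral_prod_symm G hGi']
  -- the inner integral (first coordinate), section by section
  have hinner : ∀ t : ℝ, ‖∫ s in Ioc (0 : ℝ) 1, G (s, t)‖ ≤ M * Real.exp (-(2 * π * a * |(n 0 : ℝ)|)) := fun t => by
    simp only [hG]
    have hcomm : (∫ s in Ioc (0 : ℝ) 1, fourier (-n 0) (s : UnitAddCircle) * (fourier (-n 1) (t : UnitAddCircle) *
        f (fun i => (((![s, t] : Fin 2 → ℝ) i : ℝ) : UnitAddCircle)))) =
        ∫ s in Ioc (0 : ℝ) 1, fourier (-n 1) (t : UnitAddCircle) * (fourier (-n 0) (s : UnitAddCircle) *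
          f (fun i => (((![s, t] : Fin 2 → ℝ) i : ℝ) : UnitAddCircle))) :=
      integral_congr_ae (Eventually.of_forall fun s => by ring)
    have h1 : ‖fourier (-n 1) (t : UnitAddCircle)‖ = 1 := Circle.norm_coe _
    rw [hcomm, MeasureTheory.integral_const_mul, norm_mul, h1, one_mul, ← intervalIntegral.integral_of_le zero_le_one]
    have hcongr : (∫ s in (0 : ℝ)..1, fourier (-n 0) (s : UnitAddCircle) * f (fun i => (((![s, t] : Fin 2 → ℝ) i : ℝ) : UnitAddCircle))) =
        ∫ s in (0 : ℝ)..1, v t s * Complex.exp (-(2 * π * I * (n 0) * s)) := by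
      refine intervalIntegral.integral_congr fun s _ => ?_
      rw [← hv t s, fourier_coe_apply, mul_comm]
      congr 1
      push_cast
      ring_nf
    rw [hcongr]
    exact norm_intervalIntegral_mul_cexp_le_of_periodic_strip_one ha (hd t) (hper t) (hM t) (n 0)
  have hIoc : (volume : Measure ℝ) (Ioc (0 : ℝ) 1) < ⊤ := by simp
  calc ‖∫ t in Ioc (0 : ℝ) 1, ∫ s in Ioc (0 : ℝ) 1, G (s, t)‖
      ≤ (M * Real.exp (-(2 * π * a * |(n 0 : ℝ)|))) * ((volume : Measure ℝ) (Ioc (0 : ℝ) 1)).toReal :=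
        norm_setIntegral_le_of_norm_le_const hIoc fun t _ => hinner t
    _ = M * Real.exp (-(2 * π * a * |(n 0 : ℝ)|)) := by simp

/-- **Both coordinates at once (sup-norm decay).** If the sections of a measurable `f : 𝕋² → ℂ` in EACH coordinate extend to `1`-periodic functions
holomorphic and bounded by `M` on the strip `|Im| < a`, then `‖𝓕f(n)‖ ≤ M·e^{-2πa·max(|n₀|,|n₁|)}`.
[cite: TrefethenWeideman2014, §4 Thm. 4.2]; [cite: CichowlasBrachet2005, §3 p. 242 (coordinatewise strip ⇒ `e^{-δ|k|_∞}`)] -/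
theorem norm_mFourierCoeff_le_exp_of_strip_sup {f : UnitAddTorus (Fin 2) → ℂ} (hf : Measurable f) {a M : ℝ} (ha : 0 < a)
    (v₀ v₁ : ℝ → ℂ → ℂ)
    (hd₀ : ∀ t, DifferentiableOn ℂ (v₀ t) {z : ℂ | |z.im| < a}) (hper₀ : ∀ t (z : ℂ), v₀ t (z + 1) = v₀ t z)
    (hM₀ : ∀ t (z : ℂ), |z.im| < a → ‖v₀ t z‖ ≤ M)
    (hv₀ : ∀ t s : ℝ, v₀ t s = f (fun i => (((![s, t] : Fin 2 → ℝ) i : ℝ) : UnitAddCircle)))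
    (hd₁ : ∀ s, DifferentiableOn ℂ (v₁ s) {z : ℂ | |z.im| < a}) (hper₁ : ∀ s (z : ℂ), v₁ s (z + 1) = v₁ s z)
    (hM₁ : ∀ s (z : ℂ), |z.im| < a → ‖v₁ s z‖ ≤ M)
    (hv₁ : ∀ s t : ℝ, v₁ s t = f (fun i => (((![s, t] : Fin 2 → ℝ) i : ℝ) : UnitAddCircle))) (n : Fin 2 → ℤ) :
    ‖UnitAddTorus.mFourierCoeff f n‖ ≤ M * Real.exp (-(2 * π * a * max |(n 0 : ℝ)| |(n 1 : ℝ)|)) := by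
  rcases le_total |(n 0 : ℝ)| |(n 1 : ℝ)| with h | h
  · rw [max_eq_right h]
    exact norm_mFourierCoeff_le_exp_of_strip_snd hf ha v₁ hd₁ hper₁ hM₁ hv₁ n
  · rw [max_eq_left h]
    exact norm_mFourierCoeff_le_exp_of_strip_fst hf ha v₀ hd₀ hper₀ hM₀ hv₀ n

end Literature.Analysis.Complex

end
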